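import Mathlib
import Summits.CriticalPhenomena.PercolationContinuityZ3.Theorems.PercNonProliferationPolynomialAssembly
import Summits.CriticalPhenomena.PercolationContinuityZ3.Theorems.PercNonProliferationMeanCauchySchwarz
import Summits.CriticalPhenomena.PercolationContinuityZ3.Theorems.PercNonProliferationNonProliferationPowerCap
import Summits.CriticalPhenomena.PercolationContinuityZ3.Theorems.FreeBoxSparse.Negative.CentredForms
import HarnessLib

/-!
# Crux `PercNonProliferation.SubpolynomialBlocking` (stmt-CriticalPhenomena-4446) — what the polynomial pair really
# consumes: the product form `θ(p)² ≤ 64 · E_p[N_n] · FA₂ᵖ(2n)` and the exponent trade-off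

Helper file (lead prover-line-stmt-CriticalPhenomena-4446-c5-0, line `cross-sandwich-flat-seal`), landed
`--supports stmt-CriticalPhenomena-4446`; it proves the registered stubs
`theta_sq_le_meanSpanning_mul_pairConnectivity` and `percolationContinuityZ3_of_exponents`.

Notation (all sums are the ones written in the route file `Theses/PercNonProliferation.lean`):
* `E_p[N_n] := Σ_{k < |B(n)|} P_p(∃ k+1 points of B(n), each joined inside B(2n) to ∂ⁱⁿB(2n), pairwise not
  joined inside B(2n))` — the mean number of annulus-spanning box-clusters (layer cake; the summand is
  `P(N_n ≥ k+1)`, in the tree `repEvent 3 k n`);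
* `FA₂ᵖ(m) := |B(m)|⁻² Σ_{x,y ∈ B(m)} P_p(x ↔ y inside B(m))` — the free-box pair connectivity;
* `u_n := P_{p_c}(B(n) ↮ ∂ⁱⁿB(2n) inside B(2n))` — the crux's blocking probability.

The route's `PolynomialAssembly` is `MeanCauchySchwarz → SpanningBKCap → FreeBoxPowerSaving → SubpolynomialBlocking →
θ(p_c) = 0`, and the crux enters ONLY through the BK cap `E[N_n] ≤ 1/u_n ≤ n^{s}`. This file isolates the hinge:

* `theta_sq_le_meanSpanning_mul_pairConnectivity` — **product form, every `p`, every `n ≥ 1`**: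
  `θ(p)² ≤ 64 · E_p[N_n] · FA₂ᵖ(2n)` (`MeanCauchySchwarz` `(θ|B(n)|)² ≤ E[N_n]·E[S_n]`, `E[S_n] ≤ |B(2n)|² FA₂(2n)`,
  `|B(2n)| ≤ 8|B(n)|`, the landed `FreeBoxSparse.Negative.card_box_two_mul_le`). So `θ(p_c) = 0` iff-free: it follows as soon as `liminf_n E_{p_c}[N_n] · FA₂(2n) = 0`.
* `percolationContinuityZ3_of_exponents` — **exponent trade-off**: `FA₂(n) ≤ C n^{-a}` (`n ≥ 1`) and
  `E_{p_c}[N_n] ≤ C' n^{b}` FREQUENTLY with `b < a` give `θ(p_c(ℤ³)) = 0`.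
* Instances. (i) `percolationContinuityZ3_of_meanSpanningSubpoly`: `FreeBoxPowerSaving` + "`E_{p_c}[N_n] ≤ n^{s}`
  frequently, every `s > 0`" (MEAN NON-PROLIFERATION, sub-polynomial form) close the conjunct — this hypothesis is
  implied by the crux (`SpanningBKCap` + crux, stub `meanSpanningSubpoly_of_subpolynomialBlocking`, sibling file) and
  is strictly weaker in content (it tolerates crossing w.h.p. by few spanning clusters, which the crux forbids), so it
  is the weakest form of r4 the polynomial pair needs; (ii) `percolationContinuityZ3_of_pairConnectivity_decay`:
  with the sibling crux's LANDED `NonProliferation.expected_numSpanning_le_rpow` (`E_{p_c}[N_n] ≤ C n^{2-β}`, β > 0,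
  unconditional) and the proved `meanCauchySchwarz_proof`, a free-box power saving with ANY exponent `a > 2 - β`
  gives `θ(p_c) = 0` with no blocking input at all (unconditional statement: `∃ b < 2, ∀ a > b, …`).
No new definitions; no sorry.
-/

noncomputable section

namespace Summit.CriticalPhenomena.PercolationContinuityZ3.Theorems.SubpolynomialBlocking

open MeasureTheory Filter Topology
open Literature.Probability.Percolation Literature.Probability.LatticeModels
open Summit.CriticalPhenomena.PercolationContinuityZ3.Theses.PercNonProliferation

namespace MeanSpanningTradeoff

/-- Real arithmetic of the product form: from `(θ b)² ≤ EN·ES`, `0 ≤ EN`, `ES ≤ T`, `T = F·b₂²`, `0 ≤ F`,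
`0 < b`, `0 < b₂ ≤ 8 b` conclude `θ² ≤ 64·EN·F`. -/
theorem arith {θ b b₂ EN ES T F : ℝ} (hb : 0 < b) (hb₂ : b₂ ≤ 8 * b) (hb₂0 : 0 < b₂)
    (hMCS : (θ * b) ^ 2 ≤ EN * ES) (hEN : 0 ≤ EN) (hES : ES ≤ T) (hT : T = F * b₂ ^ 2) (hF : 0 ≤ F) :
    θ ^ 2 ≤ 64 * EN * F := by
  have hb₂sq : b₂ ^ 2 ≤ 64 * b ^ 2 := by
    calc b₂ ^ 2 ≤ (8 * b) ^ 2 := pow_le_pow_left₀ hb₂0.le hb₂ 2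
      _ = 64 * b ^ 2 := by ring
  have key : θ ^ 2 * b ^ 2 ≤ 64 * EN * F * b ^ 2 := by
    calc θ ^ 2 * b ^ 2 = (θ * b) ^ 2 := by ring
      _ ≤ EN * ES := hMCS
      _ ≤ EN * T := mul_le_mul_of_nonneg_left hES hEN
      _ = EN * F * b₂ ^ 2 := by rw [hT]; ring
      _ ≤ EN * F * (64 * b ^ 2) := mul_le_mul_of_nonneg_left hb₂sq (mul_nonneg hEN hF)
      _ = 64 * EN * F * b ^ 2 := by ring
  exact le_of_mul_le_mul_right key (pow_pos hb 2)

/-- A frequently-true inequality against a sequence tending to `0` forces a square to vanish: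
if `∃ᶠ n, θ² ≤ g n` and `g → 0` then `θ = 0`. -/
theorem eq_zero_of_frequently_sq_le {θ : ℝ} {g : ℕ → ℝ} (hfreq : ∃ᶠ n : ℕ in atTop, θ ^ 2 ≤ g n)
    (hg : Tendsto g atTop (𝓝 0)) : θ = 0 := by
  have hsq : θ ^ 2 ≤ 0 := by
    by_contra hpos
    push Not at hpos
    obtain ⟨n, h1, h2⟩ := (hfreq.and_eventually (hg.eventually (gt_mem_nhds hpos))).exists
    exact absurd (h1.trans_lt h2) (lt_irrefl _)
  exact pow_eq_zero_iff two_ne_zero |>.1 (le_antisymm hsq (sq_nonneg _))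

end MeanSpanningTradeoff

open MeanSpanningTradeoff

/-- **Product form (registered stub `theta_sq_le_meanSpanning_mul_pairConnectivity`).** Under `MeanCauchySchwarz`,
for every `p` and every `n ≥ 1`: `θ(p)² ≤ 64 · E_p[N_n] · FA₂ᵖ(2n)`. Proof: `(θ|B(n)|)² ≤ E[N_n]·E[S_n]`
(`MeanCauchySchwarz`), `E[S_n] = Σ_{x,y∈B(n)} P(x ↔ y in B(2n)) ≤ Σ_{x,y∈B(2n)} P(x ↔ y in B(2n)) = FA₂(2n)·|B(2n)|²`
and `|B(2n)|² ≤ 64 |B(n)|²`. -/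
theorem theta_sq_le_meanSpanning_mul_pairConnectivity : MeanCauchySchwarz → ∀ (p : unitInterval) (n : ℕ), 1 ≤ n → (theta (zdGraph 3) (0 : Site 3) p) ^ 2 ≤ 64 * (∑ k ∈ Finset.range (box 3 n).card, (bondPercolation (zdGraph 3) p).real {ω | ∃ x : Fin (k + 1) → Site 3, (∀ i, x i ∈ box 3 n) ∧ (∀ i, ∃ y ∈ innerBoundary (zdGraph 3) (box 3 (2 * n)), ω ∈ openConnIn ↑(box 3 (2 * n)) (x i) y) ∧ ∀ i j, i ≠ j → ω ∉ openConnIn ↑(box 3 (2 * n)) (x i) (x j)}) * ((∑ x ∈ box 3 (2 * n), ∑ y ∈ box 3 (2 * n), (bondPercolation (zdGraph 3) p).real (openConnIn ↑(box 3 (2 * n)) x y)) / ((box 3 (2 * n)).card : ℝ) ^ 2) := by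
  intro hMCS p n _hn
  unfold MeanCauchySchwarz at hMCS
  have hb : (0 : ℝ) < (box 3 n).card := Nat.cast_pos.2 (Finset.card_pos.2 (box_nonempty 3 n))
  have hb₂0 : (0 : ℝ) < (box 3 (2 * n)).card := Nat.cast_pos.2 (Finset.card_pos.2 (box_nonempty 3 (2 * n)))
  set T : ℝ := ∑ x ∈ box 3 (2 * n), ∑ y ∈ box 3 (2 * n),
    (bondPercolation (zdGraph 3) p).real (openConnIn ↑(box 3 (2 * n)) x y) with hTdef
  have hT0 : 0 ≤ T := Finset.sum_nonneg fun x _ => Finset.sum_nonneg fun y _ => measureReal_nonneg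
  refine arith (T := T) hb (FreeBoxSparse.Negative.card_box_two_mul_le n) hb₂0 (hMCS p n) ?_ ?_ ?_ (div_nonneg hT0 (sq_nonneg _))
  · exact Finset.sum_nonneg fun k _ => measureReal_nonneg
  · exact polynomialAssembly_sum_sum_mono (box_mono 3 (by omega)) fun x y => measureReal_nonneg
  · field_simp

/-- **Exponent trade-off (registered stub `percolationContinuityZ3_of_exponents`).** Under `MeanCauchySchwarz`:
a free-box power saving `FA₂(n) ≤ C n^{-a}` (`n ≥ 1`) at `p_c` and a mean spanning bound `E_{p_c}[N_n] ≤ C' n^{b}`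
along ANY subsequence, with `b < a`, give `θ(p_c(ℤ³)) = 0`: at such `n`, `θ² ≤ 64 · C' n^b · C (2n)^{-a} =
64 C C' 2^{-a} n^{-(a-b)} → 0`. -/
theorem percolationContinuityZ3_of_exponents : MeanCauchySchwarz → ∀ (a b C C' : ℝ), b < a → (∀ n : ℕ, 1 ≤ n → (∑ x ∈ box 3 n, ∑ y ∈ box 3 n, (bondPercolation (zdGraph 3) (criticalProbI 3)).real (openConnIn ↑(box 3 n) x y)) / ((box 3 n).card : ℝ) ^ 2 ≤ C * (n : ℝ) ^ (-a)) → (∃ᶠ n : ℕ in atTop, (∑ k ∈ Finset.range (box 3 n).card, (bondPercolation (zdGraph 3) (criticalProbI 3)).real {ω | ∃ x : Fin (k + 1) → Site 3, (∀ i, x i ∈ box 3 n) ∧ (∀ i, ∃ y ∈ innerBoundary (zdGraph 3) (box 3 (2 * n)), ω ∈ openConnIn ↑(box 3 (2 * n)) (x i) y) ∧ ∀ i j, i ≠ j → ω ∉ openConnIn ↑(box 3 (2 * n)) (x i) (x j)}) ≤ C' * (n : ℝ) ^ b) → _root_.PercolationContinuityZ3 := by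
  intro hMCS a b C C' hba hC hEN
  refine Literature.Probability.Percolation.percolationContinuityZ3_iff.2 ?_
  -- the bound at every scale of the subsequence
  have key : ∃ᶠ n : ℕ in atTop, (theta (zdGraph 3) (0 : Site 3) (criticalProbI 3)) ^ 2 ≤
      64 * C * C' * (2 : ℝ) ^ (-a) * (n : ℝ) ^ (-(a - b)) := by
    refine (hEN.and_eventually (eventually_ge_atTop 1)).mono fun n ⟨hENn, hn⟩ => ?_
    have hn0 : (0 : ℝ) < n := Nat.cast_pos.2 (Nat.succ_le_iff.1 hn)
    have hprod := theta_sq_le_meanSpanning_mul_pairConnectivity hMCS (criticalProbI 3) n hn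
    set EN : ℝ := ∑ k ∈ Finset.range (box 3 n).card, (bondPercolation (zdGraph 3) (criticalProbI 3)).real
      {ω | ∃ x : Fin (k + 1) → Site 3, (∀ i, x i ∈ box 3 n) ∧
        (∀ i, ∃ y ∈ innerBoundary (zdGraph 3) (box 3 (2 * n)), ω ∈ openConnIn ↑(box 3 (2 * n)) (x i) y) ∧
        ∀ i j, i ≠ j → ω ∉ openConnIn ↑(box 3 (2 * n)) (x i) (x j)} with hENdef
    set F : ℝ := (∑ x ∈ box 3 (2 * n), ∑ y ∈ box 3 (2 * n),
      (bondPercolation (zdGraph 3) (criticalProbI 3)).real (openConnIn ↑(box 3 (2 * n)) x y)) /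
        ((box 3 (2 * n)).card : ℝ) ^ 2 with hFdef
    have hEN0 : 0 ≤ EN := Finset.sum_nonneg fun k _ => measureReal_nonneg
    have hF0 : 0 ≤ F := div_nonneg (Finset.sum_nonneg fun x _ => Finset.sum_nonneg fun y _ =>
      measureReal_nonneg) (sq_nonneg _)
    have hFle : F ≤ C * ((2 * n : ℕ) : ℝ) ^ (-a) := hC (2 * n) (by omega)
    have hC'0 : 0 ≤ C' * (n : ℝ) ^ b := hEN0.trans hENn
    have h2n : ((2 * n : ℕ) : ℝ) ^ (-a) = (2 : ℝ) ^ (-a) * (n : ℝ) ^ (-a) := by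
      rw [Nat.cast_mul, Nat.cast_ofNat]
      exact Real.mul_rpow (by norm_num) hn0.le
    have hcomb : (n : ℝ) ^ b * (n : ℝ) ^ (-a) = (n : ℝ) ^ (-(a - b)) := by
      rw [← Real.rpow_add hn0]
      congr 1
      ring
    calc (theta (zdGraph 3) (0 : Site 3) (criticalProbI 3)) ^ 2 ≤ 64 * EN * F := hprod
      _ ≤ 64 * (C' * (n : ℝ) ^ b) * F :=
          mul_le_mul_of_nonneg_right (mul_le_mul_of_nonneg_left hENn (by norm_num)) hF0
      _ ≤ 64 * (C' * (n : ℝ) ^ b) * (C * ((2 * n : ℕ) : ℝ) ^ (-a)) :=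
          mul_le_mul_of_nonneg_left hFle (mul_nonneg (by norm_num) hC'0)
      _ = 64 * C * C' * (2 : ℝ) ^ (-a) * ((n : ℝ) ^ b * (n : ℝ) ^ (-a)) := by rw [h2n]; ring
      _ = 64 * C * C' * (2 : ℝ) ^ (-a) * (n : ℝ) ^ (-(a - b)) := by rw [hcomb]
  have hlim : Tendsto (fun n : ℕ => 64 * C * C' * (2 : ℝ) ^ (-a) * (n : ℝ) ^ (-(a - b))) atTop (𝓝 0) := by
    have h := ((tendsto_rpow_neg_atTop (sub_pos.2 hba)).comp tendsto_natCast_atTop_atTop).const_mul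
      (64 * C * C' * (2 : ℝ) ^ (-a))
    rw [mul_zero] at h
    exact h
  exact eq_zero_of_frequently_sq_le key hlim

/-- **Mean non-proliferation (sub-polynomial form) suffices for the polynomial pair.**
`MeanCauchySchwarz → FreeBoxPowerSaving → (∀ s > 0, ∃ᶠ n, E_{p_c}[N_n] ≤ n^{s}) → θ(p_c(ℤ³)) = 0`
(trade-off with `b := a/2 < a`, `C' := 1`). The third hypothesis follows from the crux `SubpolynomialBlocking` and
the proved `SpanningBKCap` (`E[N_n] ≤ 1/u_n ≤ n^{s}`; sibling stub `meanSpanningSubpoly_of_subpolynomialBlocking`),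
so this theorem contains `polynomialAssembly_proof` with the crux replaced by a formally weaker statement. -/
theorem percolationContinuityZ3_of_meanSpanningSubpoly (hMCS : MeanCauchySchwarz) (hFPS : FreeBoxPowerSaving)
    (hEN : ∀ s : ℝ, 0 < s → ∃ᶠ n : ℕ in atTop,
      (∑ k ∈ Finset.range (box 3 n).card, (bondPercolation (zdGraph 3) (criticalProbI 3)).real
        {ω | ∃ x : Fin (k + 1) → Site 3, (∀ i, x i ∈ box 3 n) ∧
          (∀ i, ∃ y ∈ innerBoundary (zdGraph 3) (box 3 (2 * n)), ω ∈ openConnIn ↑(box 3 (2 * n)) (x i) y) ∧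
          ∀ i j, i ≠ j → ω ∉ openConnIn ↑(box 3 (2 * n)) (x i) (x j)}) ≤ (n : ℝ) ^ s) :
    _root_.PercolationContinuityZ3 := by
  unfold FreeBoxPowerSaving at hFPS
  obtain ⟨a, C, ha, hC⟩ := hFPS
  refine percolationContinuityZ3_of_exponents hMCS a (a / 2) C 1 (half_lt_self ha) hC ?_
  exact (hEN (a / 2) (half_pos ha)).mono fun n h => by rwa [one_mul]

/-- **A free-box power saving beyond the landed power cap needs no blocking input.** Unconditionally (the route's
`MeanCauchySchwarz` is proved, `meanCauchySchwarz_proof`, and the sibling crux's power cap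
`NonProliferation.expected_numSpanning_le_rpow` gives `E_{p_c}[N_n] ≤ C n^{2-β}` for some `β > 0`): there is
`b < 2` such that `FA₂(n) ≤ C n^{-a}` (`n ≥ 1`) with ANY `a > b` implies `θ(p_c(ℤ³)) = 0`. (Numerically
`FA₂(n) ≍ n^{-0.95}`, so this is bookkeeping of what is certified, not a claim that the hypothesis is expected.) -/
theorem percolationContinuityZ3_of_pairConnectivity_decay :
    ∃ b : ℝ, b < 2 ∧ ∀ a C : ℝ, b < a →
      (∀ n : ℕ, 1 ≤ n → (∑ x ∈ box 3 n, ∑ y ∈ box 3 n,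
          (bondPercolation (zdGraph 3) (criticalProbI 3)).real (openConnIn ↑(box 3 n) x y)) /
            ((box 3 n).card : ℝ) ^ 2 ≤ C * (n : ℝ) ^ (-a)) →
      _root_.PercolationContinuityZ3 := by
  obtain ⟨β, C', hβ, hcap⟩ := NonProliferation.expected_numSpanning_le_rpow
  refine ⟨2 - β, by linarith, fun a C hba hC => ?_⟩
  refine percolationContinuityZ3_of_exponents meanCauchySchwarz_proof a (2 - β) C C' hba hC ?_
  exact ((eventually_ge_atTop 1).mono fun n hn => hcap n hn).frequently

end Summit.CriticalPhenomena.PercolationContinuityZ3.Theorems.SubpolynomialBlocking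

end
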